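import Summits.Ventures.Crystal3D.Theorems.StickyWulffConstantGenericWallFloorCapTerrace
import HarnessLib

/-!
# Cap-level rigidity: adjacent parallel lines of one frame cap through a common normal at the SAME level
# (crux `GenericWallFloor`, stmt-Ventures-19480, line `WallLedgerG`)

HONEST FRAMING. Venture `Summits/Ventures/Crystal3D` (cell `crystal3d-full`), helper `--supports` the crux
`GenericWallFloor` of `route-Ventures-StickyWulffConstant`, REGISTERED line `WallLedgerG`, open stub
`stub_twoSlabAdhesion`.  Structure only; F-C1 not moved; NOT the crux.  CENSUS-FREE.  Sequel of `…CapTerrace`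
(`not_full_inPlane_neighbour_of_cap`: no in-plane neighbour of an exact oriented cap is frame-full).

THE PICTURE (arrival class, memo ARRIVING-FAMILY-g6 on the item).  A steep family of one grain runs along the parallel
lines `p + ℕ·F d` of its frame `F`; on the arrival class its walkers make FULL steps and then PUSH through an exact
oriented cap of a coherent twin terrace with normal `n` (`⟪F d, n⟫ = √(2/3)`).  Two lines are ADJACENT when they differ
by an in-plane slot `F w′` (`⟪F w′, n⟫ = 0`); adjacency is the hexagonal line lattice of the family.  Index the balls of
a line by their LEVEL `i` (the multiple of `F d`).
* **`not_full_at_cap_level_of_adjacent`** — if the line through `p` carries an `n`-cap at level `j`, the adjacent line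
  through `p + F w′` is NOT `F`-full at level `j`.  So a walker running up the adjacent line by full steps stops or caps
  at a level `≤ j` (`exists_nonFull_le_of_adjacent_cap`: some level `≤ j` of the adjacent line is not full).
* **`cap_level_eq_of_adjacent`** — if BOTH lines are full below their caps and cap through the SAME normal `n` (levels
  `j`, `j′`), then `j = j′`.  Terraces of one normal met by full runs form LEVEL SETS that are constant on connected
  clusters of the line lattice; a change of level between two capping lines needs a line in between whose run meets a
  non-full, non-`n`-cap ball at or below the lower level — a ball where the walker STOPS and pays (`…CapTerrace`,
  `inPlane_neighbour_dichotomy`), or a cap of ANOTHER normal (a foreign platelet, paid elsewhere).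
This is the census-free half of «an arriving family is not silent at riser feet»: every riser of the cap surface, however
tall, is bordered by at least one non-arriving line per in-plane line spacing.  (It is NOT proportional to the riser
height — that is the in-plane families' job; see the memo for the division of labour.)
WHAT THIS IS NOT: not the stub; no ledger; no count; F-C1 not moved.
-/

noncomputable section

namespace Summit.Ventures.Crystal3D.Theorems

open Summit.Ventures.Crystal3D Finset
open scoped InnerProductSpace

variable {X : Finset (EuclideanSpace ℝ (Fin 3))}

/-- **The adjacent line is not full at the cap's level.**  If `p + j·F d` is an exact oriented cap of `F` with normal `n`
and `⟪F w′, n⟫ = 0`, then the ball of the adjacent line `p + F w′ + ℕ·F d` at level `j` is not `F`-full. -/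
theorem not_full_at_cap_level_of_adjacent {F : EuclideanSpace ℝ (Fin 3) ≃ₗᵢ[ℝ] EuclideanSpace ℝ (Fin 3)}
    {p d n w' v : EuclideanSpace ℝ (Fin 3)} {j : ℕ} (hcap : IsOrientedCap X F (p + (j : ℝ) • F d) v n)
    (hw' : w' ∈ fccSlots) (hw'n : ⟪F w', n⟫_ℝ = 0) :
    ¬ ∀ w ∈ fccSlots, p + F w' + (j : ℝ) • F d + F w ∈ X := by
  have h := not_full_inPlane_neighbour_of_cap hcap hw' hw'n
  have e : p + F w' + (j : ℝ) • F d = p + (j : ℝ) • F d + F w' := add_right_comm _ _ _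
  rw [e]; exact h

/-- Hence some level `≤ j` of the adjacent line is not full: a full run up the adjacent line ends (stop or cap) at a level
at most the cap level of its neighbour. -/
theorem exists_nonFull_le_of_adjacent_cap {F : EuclideanSpace ℝ (Fin 3) ≃ₗᵢ[ℝ] EuclideanSpace ℝ (Fin 3)}
    {p d n w' v : EuclideanSpace ℝ (Fin 3)} {j : ℕ} (hcap : IsOrientedCap X F (p + (j : ℝ) • F d) v n)
    (hw' : w' ∈ fccSlots) (hw'n : ⟪F w', n⟫_ℝ = 0) :
    ∃ i ≤ j, ¬ ∀ w ∈ fccSlots, p + F w' + (i : ℝ) • F d + F w ∈ X :=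
  ⟨j, le_rfl, not_full_at_cap_level_of_adjacent hcap hw' hw'n⟩

/-- **Cap-level rigidity.**  Two adjacent lines (`p + ℕ·F d` and `p + F w′ + ℕ·F d`, `⟪F w′, n⟫ = 0`) that are `F`-full
below levels `j`, `j′` and carry exact oriented caps of the SAME unit menu normal `n` at those levels have `j = j′`. -/
theorem cap_level_eq_of_adjacent {F : EuclideanSpace ℝ (Fin 3) ≃ₗᵢ[ℝ] EuclideanSpace ℝ (Fin 3)}
    {p d n w' v v' : EuclideanSpace ℝ (Fin 3)} {j j' : ℕ}
    (hcap : IsOrientedCap X F (p + (j : ℝ) • F d) v n)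
    (hfull : ∀ i : ℕ, i < j → ∀ w ∈ fccSlots, p + (i : ℝ) • F d + F w ∈ X)
    (hw' : w' ∈ fccSlots) (hw'n : ⟪F w', n⟫_ℝ = 0)
    (hcap' : IsOrientedCap X F (p + F w' + (j' : ℝ) • F d) v' n)
    (hfull' : ∀ i : ℕ, i < j' → ∀ w ∈ fccSlots, p + F w' + (i : ℝ) • F d + F w ∈ X) : j = j' := by
  rcases lt_trichotomy j j' with h | h | h
  · exact absurd (hfull' j h) (not_full_at_cap_level_of_adjacent hcap hw' hw'n)
  · exact h
  · exfalso
    -- the first line is full at level `j′`, but its ball there is the in-plane neighbour `−w′` of the second cap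
    have hmw' : -w' ∈ fccSlots := neg_mem_fccSlots hw'
    have hmw'n : ⟪F (-w'), n⟫_ℝ = 0 := by rw [map_neg, inner_neg_left, hw'n, neg_zero]
    have hnf := not_full_inPlane_neighbour_of_cap hcap' hmw' hmw'n
    have e : p + F w' + (j' : ℝ) • F d + F (-w') = p + (j' : ℝ) • F d := by rw [map_neg]; abel
    rw [e] at hnf
    exact hnf (hfull j' h)

/-- **Monotone form.**  If the first line is full below level `j` and caps (normal `n`) at `j`, and the adjacent line is
full below level `j′` with `j′ ≥ j`, then `j′ = j`: the adjacent run cannot climb past its neighbour's cap level. -/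
theorem level_le_of_adjacent_cap {F : EuclideanSpace ℝ (Fin 3) ≃ₗᵢ[ℝ] EuclideanSpace ℝ (Fin 3)}
    {p d n w' v : EuclideanSpace ℝ (Fin 3)} {j j' : ℕ}
    (hcap : IsOrientedCap X F (p + (j : ℝ) • F d) v n) (hw' : w' ∈ fccSlots) (hw'n : ⟪F w', n⟫_ℝ = 0)
    (hfull' : ∀ i : ℕ, i < j' → ∀ w ∈ fccSlots, p + F w' + (i : ℝ) • F d + F w ∈ X) : j' ≤ j := by
  by_contra h
  push Not at h
  exact not_full_at_cap_level_of_adjacent hcap hw' hw'n (hfull' j h)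

end Summit.Ventures.Crystal3D.Theorems

end
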